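import Summits.ABC.StewartYu.PadicTwoMain
import Summits.ABC.StewartYu.DescentThirdLiouvilleQ
import HarnessLib

/-!
# Cell abc-stewartyu, W80Two (viii): the assembled `2`-adic contradiction — parameter pack, the
# inner-step inequality in logarithmic form, the third step from numerics

`Summits/ABC/StewartYu/PadicTwoAssembly.lean` — cell `abc-stewartyu` (seat p2; crux `W80Two`
stmt-ABC-19486), sequel to `PadicTwoMain.lean` and to p3's `DescentThirdLiouvilleQ.lean`.  One
structure + theorems; no named fact.  TWIN of p2's `PadicTwistAssembly.lean` for `S : TwoSetup`:

* `ParamPack3 U` — every input of `TwoSetup.main3` bundled at the exponent `U` (`log 8 ≤ U` replaces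
  `log p ≤ U`: the smallness `‖Λ₀‖₂ ≤ e^{−U}` must give `‖Λ₀‖₂ ≤ 8⁻¹`, the hypothesis of the `2`-adic
  Lemma 9); `not_norm_Λ₀_le_of_paramPack3`, `ParamPack3.mono`, `norm_Λ₀_gt_of_paramPack3_le`;
* `kFinal3_of_log_ineq` — `KFinal3` from the two inequalities between logarithms the parameter
  record proves: (1) `(hLb + t + condExp 2 N t)·log 2 + log(Dmax·Mmax) < U` and
  (2) `hLb·log 8 + log(Dmax·Mmax) < (2⌊N/3⌋·t)·log 4`, `N = 3^{k+J} S₀`;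
* `norm_Φ_third_le_of_chain`, **`thirdStep_of_numerics`** — the `Prop` `ThirdStep` from per-`(s,τ)`
  denominators/sizes of the third-point weights and the third-point inequality (the Schwarz bound
  `norm_Φ_le_of_zeros3` at `z = s·3⁻¹` with `N = 3^{d+J} S₀` zeros-range, p3's `2`-adic multicubic
  Liouville junction `classVec3_eq_zero_of_norm_Φ_third_lt`, and the algebraic third step
  `SetupQ.descent_algebra3`), in the style of p3's `halfStepPM_of_numerics`.

## References
* [Yu1989] K. Yu, Acta Arith. 53 (1989), §3.
* [Waldschmidt1980] M. Waldschmidt, Acta Arith. 37 (1980), Prop. 3.8 and §§3.2–3.5.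
-/

noncomputable section

open NormedSpace Finset IsUltrametricDist
open Literature.NumberTheory.Transcendental
open Literature.NumberTheory.Transcendental.CW77.Setup (Idx Tau tauNorm)
open Literature.NumberTheory.Transcendental.PadicCW77 (condExp)
open scoped Nat

namespace Summit.ABC.StewartYu

namespace TwoSetup

variable (S : TwoSetup)

/-! ### The parameter pack of the `2`-adic machine -/

/-- **A parameter pack for the `2`-adic set-up `S` at exponent `U`**: box parameters `h, Lb`,
descent parameters `J₀, L, L_θ, S₀, T, P, t`, size functions `Dmax, Mmax`, and the inputs of `TwoSetup.main3`: `1 ≤ t J`, `log 8 ≤ U`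
(so that `e^{−U} ≤ 8⁻¹`), the sizes `KSizes3`, Siegel at level `0`, the endgame at level `J₀`, and —
under `‖Λ₀‖₂ ≤ e^{−U}` — the inequalities `KFinal3` and the third steps.
[cite: Yu1989, §3] [cite: Waldschmidt1980, §§3.2–3.5 (pp. 264–274)] -/
structure ParamPack3 (U : ℝ) where
  /-- `h`: number of `Δ`-polynomials `Δ(X;r)`, `r < h` -/
  h : ℕ
  /-- `Lb`: range of the exponent of `Δ(X;h)` -/
  Lb : ℕ
  /-- the depth of the descent -/
  J₀ : ℕ
  /-- ranges of the free exponents -/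
  L : Fin S.d → ℕ
  /-- range of the eliminated exponent -/
  Lθ : ℕ
  /-- number of points at level `0` -/
  S₀ : ℕ
  /-- number of derivatives at level `0` -/
  T : ℕ
  /-- the integer bound for the coefficients -/
  P : ℤ
  /-- multiplicity of the inner steps at level `J` -/
  t : ℕ → ℕ
  /-- denominator bounds `Dmax J k` -/
  Dmax : ℕ → ℕ → ℝ
  /-- archimedean size bounds `Mmax J k` -/
  Mmax : ℕ → ℕ → ℝ
  /-- `t J ≥ 1` -/
  ht : ∀ J, J < J₀ → 1 ≤ t J
  /-- `log 8 ≤ U` (so that `e^{−U} ≤ 8⁻¹`) -/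
  hU8 : Real.log 8 ≤ U
  /-- the archimedean sizes of the cores at every level -/
  hsz : ∀ J, J < J₀ → ∀ pv : Idx S.d h Lb → ℤ, S.toQ.Inv3 J₀ L Lθ S₀ T P J pv →
    S.KSizes3 J₀ J L Lθ S₀ T (t J) pv (Dmax J) (Mmax J)
  /-- the numerical inequalities of the inner steps, from the smallness of `Λ₀` -/
  hfin : ‖S.Λ₀‖ ≤ Real.exp (-U) → ∀ J, J < J₀ →
    S.KFinal3 (h := h) (Lb := Lb) J S₀ (t J) (Dmax J) (Mmax J)
  /-- the third steps, from the smallness of `Λ₀` -/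
  hthird : ‖S.Λ₀‖ ≤ Real.exp (-U) → ∀ J, J < J₀ →
    S.ThirdStep (h := h) (Lb := Lb) J₀ J L Lθ S₀ T (t J) P
  /-- Siegel's lemma at level `0` -/
  hsiegel : S.Siegel3 (h := h) (Lb := Lb) J₀ L Lθ S₀ T P
  /-- the contradiction at level `J₀` -/
  hend : S.Endgame3 (h := h) (Lb := Lb) J₀ L Lθ S₀ T P

/-- **A parameter pack at exponent `U` forbids `‖Λ₀‖₂ ≤ e^{−U}`.** [cite: Yu1989, §3] -/
theorem not_norm_Λ₀_le_of_paramPack3 {U : ℝ} (pk : S.ParamPack3 U) :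
    ¬ ‖S.Λ₀‖ ≤ Real.exp (-U) := by
  intro hle
  have hΛ : ‖S.Λ₀‖ ≤ (8 : ℝ)⁻¹ := by
    refine hle.trans ?_
    rw [← Real.exp_log (by norm_num : (0 : ℝ) < 8), ← Real.exp_neg, Real.exp_le_exp]
    exact neg_le_neg pk.hU8
  exact S.main3 pk.ht hΛ pk.hsz (pk.hfin hle) (pk.hthird hle) pk.hsiegel pk.hend

/-- **Packs are monotone in the exponent.** [cite: Waldschmidt1980, Prop. 3.8 (p. 263)] -/
def ParamPack3.mono {S : TwoSetup} {U U' : ℝ} (pk : S.ParamPack3 U) (hU : U ≤ U') :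
    S.ParamPack3 U' where
  h := pk.h
  Lb := pk.Lb
  J₀ := pk.J₀
  L := pk.L
  Lθ := pk.Lθ
  S₀ := pk.S₀
  T := pk.T
  P := pk.P
  t := pk.t
  Dmax := pk.Dmax
  Mmax := pk.Mmax
  ht := pk.ht
  hU8 := pk.hU8.trans hU
  hsz := pk.hsz
  hfin hΛ := pk.hfin (hΛ.trans (Real.exp_le_exp.mpr (neg_le_neg hU)))
  hthird hΛ := pk.hthird (hΛ.trans (Real.exp_le_exp.mpr (neg_le_neg hU)))
  hsiegel := pk.hsiegel
  hend := pk.hend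

/-- From a pack at any exponent `U ≤ U'`: `‖Λ₀‖₂ > e^{−U'}`. [cite: Waldschmidt1980, Prop. 3.8] -/
theorem norm_Λ₀_gt_of_paramPack3_le {S : TwoSetup} {U U' : ℝ} (hU : U ≤ U') (pk : S.ParamPack3 U) :
    Real.exp (-U') < ‖S.Λ₀‖ :=
  not_le.mp (S.not_norm_Λ₀_le_of_paramPack3 (pk.mono hU))

/-! ### The inner-step inequality in logarithmic form -/

/-- `2^n = exp(n log 2)`. [folklore] -/
theorem two_pow_eq_exp (n : ℕ) : (2 : ℝ) ^ n = Real.exp ((n : ℝ) * Real.log 2) := by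
  rw [← Real.rpow_natCast, Real.rpow_def_of_pos (by norm_num : (0 : ℝ) < 2)]; congr 1; ring

/-- `4^n = exp(n log 4)`. [folklore] -/
theorem four_pow_eq_exp (n : ℕ) : (4 : ℝ) ^ n = Real.exp ((n : ℝ) * Real.log 4) := by
  rw [← Real.rpow_natCast, Real.rpow_def_of_pos (by norm_num : (0 : ℝ) < 4)]; congr 1; ring

/-- `8^n = exp(n log 8)`. [folklore] -/
theorem eight_pow_eq_exp (n : ℕ) : (8 : ℝ) ^ n = Real.exp ((n : ℝ) * Real.log 8) := by
  rw [← Real.rpow_natCast, Real.rpow_def_of_pos (by norm_num : (0 : ℝ) < 8)]; congr 1; ring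

/-- **`KFinal3` from two inequalities between logarithms**: with `N = 3^{k+J} S₀`, if
`‖Λ₀‖₂ ≤ e^{−U}` and for every `k < d`
(1) `(hLb + t + condExp 2 N t)·log 2 + log(Dmax·Mmax) < U` and
(2) `hLb·log 8 + log(Dmax·Mmax) < (2⌊N/3⌋·t)·log 4`, then `KFinal3 J S₀ t Dmax Mmax` — the Schwarz
gain is `log 4` PER ZERO at `2⌊N/3⌋` zeros. [cite: Yu1989, §3 Lemma 3.3]
[cite: Waldschmidt1980, Lemma 3.6 (p. 272)] -/
theorem kFinal3_of_log_ineq {h Lb : ℕ} {U : ℝ} (J S₀ t : ℕ) (Dmax Mmax : ℕ → ℝ)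
    (hΛ : ‖S.Λ₀‖ ≤ Real.exp (-U)) (hDM : ∀ k, k < S.d → 0 < Dmax k ∧ 0 < Mmax k)
    (h1 : ∀ k, k < S.d →
      ((h * Lb + t + condExp 2 (3 ^ (k + J) * S₀) t : ℕ) : ℝ) * Real.log 2 +
          Real.log (Dmax k * Mmax k) < U)
    (h2 : ∀ k, k < S.d →
      ((h * Lb : ℕ) : ℝ) * Real.log 8 + Real.log (Dmax k * Mmax k) <
        ((2 * (3 ^ (k + J) * S₀ / 3) * t : ℕ) : ℝ) * Real.log 4) :
    S.KFinal3 (h := h) (Lb := Lb) J S₀ t Dmax Mmax := by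
  intro k hk
  obtain ⟨hD, hM⟩ := hDM k hk
  have hDM0 : 0 < Dmax k * Mmax k := mul_pos hD hM
  have hinv : 1 / (Dmax k * Mmax k) = Real.exp (-Real.log (Dmax k * Mmax k)) := by
    rw [Real.exp_neg, Real.exp_log hDM0, one_div]
  rw [hinv]
  refine max_lt ?_ ?_
  · rcases (norm_nonneg S.Λ₀).eq_or_lt with h0 | hpos
    · rw [← h0]; simp [Real.exp_pos]
    · have e1 : (2 : ℝ) ^ (h * Lb) * ‖S.Λ₀‖ * (2 : ℝ) ^ t *
          (2 : ℝ) ^ condExp 2 (3 ^ (k + J) * S₀) t =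
          Real.exp (((h * Lb : ℕ) : ℝ) * Real.log 2 + Real.log ‖S.Λ₀‖ +
            ((t : ℕ) : ℝ) * Real.log 2 +
            (condExp 2 (3 ^ (k + J) * S₀) t : ℝ) * Real.log 2) := by
        rw [two_pow_eq_exp, two_pow_eq_exp, two_pow_eq_exp, ← Real.exp_log hpos]
        simp only [← Real.exp_add, Real.log_exp]
      rw [e1, Real.exp_lt_exp]
      have hlog : Real.log ‖S.Λ₀‖ ≤ -U := by
        have := Real.log_le_log hpos hΛ; rwa [Real.log_exp] at this
      have h1k := h1 k hk
      push_cast at h1k ⊢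
      linarith
  · have e2 : (8 : ℝ) ^ (h * Lb) / (4 : ℝ) ^ (2 * (3 ^ (k + J) * S₀ / 3) * t) =
        Real.exp (((h * Lb : ℕ) : ℝ) * Real.log 8 -
          ((2 * (3 ^ (k + J) * S₀ / 3) * t : ℕ) : ℝ) * Real.log 4) := by
      rw [eight_pow_eq_exp, four_pow_eq_exp, ← Real.exp_sub]
    rw [e2, Real.exp_lt_exp]
    have h2k := h2 k hk
    linarith

/-! ### The third step from per-`(s,τ)` numerics -/

section ThirdStep

variable {h Lb : ℕ}

/-- **The `2`-adic smallness at the third points of level `J`** from the vanishing delivered by the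
inner chain (`s' < 3^{d+J} S₀`, `3 ∤ s'`, `|τ''| < T/3ᴶ − d t`): for `s < 3^{J+1} S₀` and
`|τ| < T/3^{J+1}` (room `|τ| + t ≤ T/3ᴶ − d t`),
`‖φ_{J,τ}(s/3)‖₂ ≤ max (2^{hLb} ‖Λ₀‖₂ 2ᵗ 2^{condExp 2 N t}) (8^{hLb}/4^{2⌊N/3⌋ t})`, `N = 3^{d+J} S₀`
(`norm_Φ_le_of_zeros3` at `z = s · 3⁻¹`). [cite: Yu1989, §3 Lemma 3.4] -/
theorem norm_Φ_third_le_of_chain {J₀ J : ℕ} {L : Fin S.d → ℕ} {Lθ S₀ T t : ℕ}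
    {pv : Idx S.d h Lb → ℤ} (ht : 1 ≤ t) (hΛ : ‖S.Λ₀‖ ≤ (8 : ℝ)⁻¹)
    (hvan : ∀ s, s < 3 ^ (S.d + J) * S₀ → ¬ 3 ∣ s → ∀ τ : Tau S.d,
      tauNorm τ < T / 3 ^ J - S.d * t →
      S.toQ.coreSum3 J₀ J (S.toQ.box3 (h := h) (Lb := Lb) L Lθ J) pv τ s = 0)
    (τ : Tau S.d) (hτ : tauNorm τ + t ≤ T / 3 ^ J - S.d * t) (s : ℕ) :
    ‖S.Φ J₀ J (S.toQ.box3 (h := h) (Lb := Lb) L Lθ J) pv τ ((s : ℚ_[2]) * ((3 : ℕ) : ℚ_[2])⁻¹)‖ ≤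
      max ((2 : ℝ) ^ (h * Lb) * ‖S.Λ₀‖ * (2 : ℝ) ^ t *
            (2 : ℝ) ^ condExp 2 (3 ^ (S.d + J) * S₀) t)
        ((8 : ℝ) ^ (h * Lb) / (4 : ℝ) ^ (2 * (3 ^ (S.d + J) * S₀ / 3) * t)) := by
  have hzeroΦ : ∀ s', s' < 3 ^ (S.d + J) * S₀ → ¬ 3 ∣ s' → ∀ τ'' : Tau S.d,
      tauNorm τ'' < T / 3 ^ J - S.d * t →
      S.Φ J₀ J (S.toQ.box3 (h := h) (Lb := Lb) L Lθ J) pv τ'' (s' : ℚ_[2]) = 0 :=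
    fun s' hs' h3 τ'' hτ'' => by
      rw [S.Φ_natCast3, hvan s' hs' h3 τ'' hτ'', Rat.cast_zero]
  exact (S.norm_Φ_le_of_zeros3 J₀ J _ pv ht hzeroΦ hΛ (TwoAdic.norm_natCast_mul_inv_three_le s) τ hτ).2

/-- **The third step from per-`(s,τ)` numerics** (twin of p3's `halfStepPM_of_numerics`): for INTEGER
generators with the cube-Kummer condition, given `t ≥ 1`, `‖Λ₀‖₂ ≤ 8⁻¹`, room
`|τ| < T/3^{J+1} ⇒ |τ| + t ≤ T/3ᴶ − d t`, denominators `D(s,τ) ≥ 1` clearing the third-point weights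
`qΔ3_{J+1}(u) qA(u) qEt(u,s)` on the box of level `J`, bounds `Mb(s,τ) ≥ ∑_u P·|qΔ3_{J+1} qA qEt|`
(`Mb ≥ 1`), and the third-point inequality
`max (2^{hLb} ‖Λ₀‖₂ 2ᵗ 2^{condExp 2 N t}) (8^{hLb}/4^{2⌊N/3⌋ t}) < 1/(6 D Mb ∏ max(1,|allᵢ|))^{3^{d+2}−1}`
(`N = 3^{d+J} S₀`) at every `s < 3^{J+1} S₀`, `3 ∤ s`, `|τ| < T/3^{J+1}`: the `Prop` `ThirdStep`
(`norm_Φ_le_of_zeros3` at `s/3`, p3's `classVec3_eq_zero_of_norm_Φ_third_lt`, `descent_algebra3`).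
[cite: Yu1989, §3 Lemmas 3.4–3.5] -/
theorem thirdStep_of_numerics {J₀ J : ℕ} (hJ : J < J₀) {L : Fin S.d → ℕ} {Lθ S₀ T t : ℕ} {P : ℤ}
    (ht : 1 ≤ t) (hΛ : ‖S.Λ₀‖ ≤ (8 : ℝ)⁻¹)
    (hroom : ∀ τ : Tau S.d, tauNorm τ < T / 3 ^ (J + 1) → tauNorm τ + t ≤ T / 3 ^ J - S.d * t)
    (hint : ∀ i, ∃ a : ℤ, S.toQ.all i = a)
    (hind : ∀ κ : Fin (S.d + 1) → ℕ, (∃ j, ¬ 3 ∣ κ j) → ∀ γ : ℚ, ∏ j, S.toQ.all j ^ κ j ≠ γ ^ 3)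
    (D : ℕ → Tau S.d → ℕ) (hD : ∀ s τ, 1 ≤ D s τ)
    (hDc : ∀ s (τ : Tau S.d), ∀ u ∈ S.toQ.box3 (h := h) (Lb := Lb) L Lθ J,
      ∃ z : ℤ, (D s τ : ℚ) *
        ((S.toQ.qΔ3 J₀ (J + 1) u τ.1 s * S.frame.qA u τ.2) * S.toQ.qEt u s) = z)
    (Mb : ℕ → Tau S.d → ℝ) (hMb : ∀ s τ, 1 ≤ Mb s τ)
    (hMbP : ∀ s (τ : Tau S.d), ∑ u ∈ S.toQ.box3 (h := h) (Lb := Lb) L Lθ J,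
      (P : ℝ) * |((S.toQ.qΔ3 J₀ (J + 1) u τ.1 s * S.frame.qA u τ.2 * S.toQ.qEt u s : ℚ) : ℝ)| ≤
        Mb s τ)
    (hfinal : ∀ s, s < 3 ^ (J + 1) * S₀ → ¬ 3 ∣ s → ∀ τ : Tau S.d, tauNorm τ < T / 3 ^ (J + 1) →
      max ((2 : ℝ) ^ (h * Lb) * ‖S.Λ₀‖ * (2 : ℝ) ^ t *
            (2 : ℝ) ^ condExp 2 (3 ^ (S.d + J) * S₀) t)
          ((8 : ℝ) ^ (h * Lb) / (4 : ℝ) ^ (2 * (3 ^ (S.d + J) * S₀ / 3) * t)) <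
        1 / (6 * (D s τ : ℝ) * Mb s τ * ∏ i, max 1 |(S.toQ.all i : ℝ)|) ^ (3 ^ (S.d + 1 + 1) - 1)) :
    S.ThirdStep (h := h) (Lb := Lb) J₀ J L Lθ S₀ T t P := by
  intro pv inv hvan
  refine S.toQ.descent_algebra3 inv fun s hs h3 τ hτ => ?_
  -- the `ℓ¹`-bound of the class sums from `|p(u)| ≤ P`
  have hcM : ∑ κ, |(S.toQ.classVec3 (S.toQ.box3 (h := h) (Lb := Lb) L Lθ J) pv
      (fun u => S.toQ.qΔ3 J₀ (J + 1) u τ.1 s * S.frame.qA u τ.2) s κ : ℝ)| ≤ Mb s τ := by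
    refine (S.toQ.sum_abs_classVec3_le _ pv _ s).trans (le_trans ?_ (hMbP s τ))
    refine sum_le_sum fun u _ => ?_
    have hb : |(pv u : ℝ)| ≤ (P : ℝ) := by exact_mod_cast inv.bound u
    rw [show S.toQ.qΔ3 J₀ (J + 1) u τ.1 s * S.frame.qA u τ.2 * S.toQ.qEt u s =
      (S.toQ.qΔ3 J₀ (J + 1) u τ.1 s * S.frame.qA u τ.2) * S.toQ.qEt u s by ring]
    exact mul_le_mul_of_nonneg_right hb (abs_nonneg _)
  have hsmall := lt_of_le_of_lt (S.norm_Φ_third_le_of_chain ht hΛ hvan τ (hroom τ hτ) s)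
    (hfinal s hs h3 τ hτ)
  exact S.classVec3_eq_zero_of_norm_Φ_third_lt hint hind hJ _ pv τ s (hD s τ) (hDc s τ) (hMb s τ)
    hcM hsmall

end ThirdStep

end TwoSetup

end Summit.ABC.StewartYu

end
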